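import Literature.AlgebraicGeometry.Motives.ProjectiveDescentNormProofs
import Mathlib.AlgebraicGeometry.Morphisms.Finite
import HarnessLib

/-!
# The norm map of a finite family of morphisms to `Proj A`: an invariant FINITE morphism to `ℙᴸ`

Topic `Literature/AlgebraicGeometry/Motives` (definitions with bodies and theorems; no named facts).

Classical statement (Mumford, *Abelian Varieties* §7, proof of the Theorem p. 66 and Remark p. 69;
Harris, *Algebraic Geometry*, Lecture 10, "quotients of projective varieties by finite groups are
projective"; Serre, *Groupes algébriques et corps de classes* III §12 Prop. 19): for a finite group
`G` acting on a projective variety `X ⊆ ℙⁿ` the NORMS `N(F) = ∏_{g ∈ G} g^* F` of forms `F` are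
`G`-invariant sections without common zero, and the morphism they define is finite and
`G`-invariant (it factors through `X/G` and exhibits `X/G` as projective). The tree has the quotient
`X/G` (`Motives/FiniteQuotient`) but no ample-line-bundle vocabulary to state its projectivity; this
file constructs the invariant finite morphism DIRECTLY, in the chart language of
`Motives/MorphismsToProjectiveSpace` (Hartshorne II Thm. 7.1 as `GeneratingSections` data), for an
arbitrary finite family of morphisms `r_i : Y ⟶ Proj A` (`i : κ`) in place of the translates
`g ≫ r` of one morphism:

* §1 `GeneratingSections.iInfProd` — the "diagonal tensor product" of finitely many
  generating-sections data `D_i` with a common index type: charts `⋂_i U_i(α)`, ratios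
  `∏_i (s^i_β / s^i_α)` (the sections `⊗_i s^i_α` of `⊗_i 𝓛_i`), under the hypothesis that the
  charts `⋂_i U_i(α)` still cover.
* §2 `normData r F` — for forms `F_α ∈ A_m` (`m > 0`) such that the opens
  `U_α = ⋂_i r_i⁻¹ D₊(F_α)` cover `Y`: the data with charts `U_α` and ratios
  `∏_i r_i^*((F_β/F_α)^m)` (`iInfProd` of the tree's `GeneratingSections.ofForms (r i) F`), i.e. the
  sections `N(F_α) = ∏_i r_i^* F_α^m`; `normMap` — the morphism `N : Y ⟶ ℙᴸ_k` it defines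
  (`L + 1` forms), with `N⁻¹ D₊(y_α) = U_α` (`normMap_left_preimage_basicOpen`); **`N` is affine**
  when the `r_i` are affine morphisms and `Y` is separated (`isAffineHom_normMap_left`: the `U_α` are
  finite intersections of affine opens), hence **finite when `Y` is proper over `k`**
  (`isFinite_normMap_left`, Mathlib `IsFinite.iff_isProper_and_isAffineHom`).
* §3 **Invariance** (`comp_normMap_eq`): if `g : Y ⟶ Y` over `k` permutes the family,
  `g ≫ r_i = r_{σ i}` for a permutation `σ` of `κ`, then `g ≫ N = N` — the charts are `g`-stable
  and the ratios `g`-invariant (`formHomRatio_eq_appLE`: the tree's ratio `r^*((F_β/F_α)^m)` is the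
  pull-back `r^*` of the section `(F_β/F_α)^m ∈ Γ(Proj A, D₊(F_α))`, so it is natural in `r`), and
  a morphism defined by generating sections is determined by its charts and ratios
  (`GeneratingSections.chartMap_congr`).

Application (`HodgeTheory/InvariantFiniteMorphism`): for an automorphism `f` of finite order `m` of
a projective `k`-scheme `X ↪ ℙⁿ`, the family `r_i = f^i ≫ ι` (`i : ZMod m`) is permuted by `f`, so
`N` is a finite `f`-invariant morphism `X ⟶ ℙᴸ`; its general hyperplane sections are the smooth
`f`-STABLE hypersurface sections of `X` (Bertini for base-point-free systems, the tree's fact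
`HodgeTheory.Hartshorne1977_bertini_finiteMorphism`).

## References

* [MumfordAV1970] D. Mumford, *Abelian Varieties* (1970), §7, Theorem p. 66 and Remark p. 69.
* [Harris1992] J. Harris, *Algebraic Geometry: A First Course*, GTM 133, Lecture 10 (quotients).
* [Hartshorne1977] R. Hartshorne, *Algebraic Geometry*, II Thm. 7.1, II Prop. 2.5 (b), II Ex. 5.7.
* [GortzWedhorn2020] U. Görtz, T. Wedhorn, *Algebraic Geometry I*, 2nd ed., Prop. 13.66 (norm of an
  ample line bundle), Thm. 13.84 (finite ⇔ affine for proper morphisms to `ℙ(𝓔)`).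
-/

noncomputable section

universe u

open CategoryTheory AlgebraicGeometry Limits HomogeneousLocalization TopologicalSpace Opposite
open Literature.AlgebraicGeometry.Motives.Segre

namespace Literature.AlgebraicGeometry.Motives

attribute [local instance] MvPolynomial.gradedAlgebra

/-- Preimages commute with finite intersections of opens. [cite: Hartshorne1977, II Ex. 4.3] -/
theorem preimage_iInf {X Y : Scheme.{u}} (f : X ⟶ Y) {κ : Type} [Fintype κ] (U : κ → Y.Opens) :
    f ⁻¹ᵁ (⨅ i, U i) = ⨅ i, f ⁻¹ᵁ U i := by
  rw [← Finset.inf_univ_eq_iInf, ← Finset.inf_univ_eq_iInf]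
  exact Finset.apply_inf_eq_inf_comp (fun V : Y.Opens ↦ f ⁻¹ᵁ V) (fun _ _ ↦ rfl) rfl

namespace GeneratingSections

/-! ### §1 The diagonal tensor product of finitely many generating-sections data -/

section IInfProd

variable {Γ : Type} {Y : Scheme.{u}} {κ : Type} [Fintype κ] (D : κ → GeneratingSections Γ Y)

omit [Fintype κ] in
/-- Restricting twice is restricting once (any two parallel arrows of opens agree). [folklore] -/
private theorem map_map {U V W : Y.Opens} (h₁ : V ≤ U) (h₂ : W ≤ V) (s : Γ(Y, U)) :
    Y.presheaf.map (homOfLE h₂).op (Y.presheaf.map (homOfLE h₁).op s) =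
      Y.presheaf.map (homOfLE (h₂.trans h₁)).op s := by
  rw [← CommRingCat.comp_apply, ← Functor.map_comp]
  rfl

omit [Fintype κ] in
/-- The basic open of a finite product of sections over `V` is `V` met with the basic opens of
the factors. [folklore] -/
private theorem basicOpen_finset_prod {V : Y.Opens} (g : κ → Γ(Y, V)) (s : Finset κ) :
    Y.basicOpen (∏ i ∈ s, g i) = V ⊓ ⨅ i ∈ s, Y.basicOpen (g i) := by
  classical
  induction s using Finset.induction_on with
  | empty =>
    rw [Finset.prod_empty, Scheme.basicOpen_of_isUnit _ isUnit_one]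
    simp
  | insert a s ha ih =>
    rw [Finset.prod_insert ha, Scheme.basicOpen_mul, ih, Finset.iInf_insert]
    apply le_antisymm
    · exact le_inf (inf_le_right.trans inf_le_left)
        (le_inf inf_le_left (inf_le_right.trans inf_le_right))
    · exact le_inf (inf_le_right.trans inf_le_left)
        (le_inf inf_le_left (inf_le_right.trans inf_le_right))

/-- **The diagonal tensor product of finitely many generating-sections data** `D_i` (`i : κ`) on `Y`
with a common index type `Γ`: charts `U α = ⋂_i (D i).U α` (where all the sections `s^i_α`
generate), ratios `∏_i s^i_β / s^i_α` — the ratios of the sections `⊗_i s^i_α` of the tensor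
product `⊗_i 𝓛_i` of the invertible sheaves glued from the `D_i` (Hartshorne II Ex. 5.18; Görtz–
Wedhorn I (11.7)) —, under the hypothesis `hcov` that the charts `⋂_i (D i).U α` cover `Y`.
[cite: Hartshorne1977, II Thm. 7.1 (proof) and II Ex. 5.18] -/
def iInfProd (hcov : ⨆ α, (⨅ i, (D i).U α) = ⊤) : GeneratingSections Γ Y where
  U α := ⨅ i, (D i).U α
  iSup_U := hcov
  ratio α β := ∏ i, Y.presheaf.map (homOfLE (iInf_le (fun i ↦ (D i).U α) i)).op ((D i).ratio α β)
  ratio_self α := by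
    simp_rw [(D _).ratio_self, map_one]
    exact Finset.prod_const_one
  basicOpen_ratio α β := by
    rw [basicOpen_finset_prod]
    simp_rw [Scheme.basicOpen_res, (D _).basicOpen_ratio]
    apply le_antisymm
    · refine le_inf inf_le_left (le_iInf fun i ↦ ?_)
      exact inf_le_right.trans ((iInf_le _ i).trans
        ((iInf_le (fun _ : i ∈ (Finset.univ : Finset κ) ↦ _) (Finset.mem_univ i)).trans
          (inf_le_right.trans inf_le_right)))
    · refine le_inf inf_le_left (le_iInf fun i ↦ le_iInf fun _ ↦ ?_)
      exact le_inf inf_le_left (le_inf (inf_le_left.trans (iInf_le _ i))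
        (inf_le_right.trans (iInf_le _ i)))
  ratio_mul_ratio α β δ := by
    rw [map_prod, map_prod, map_prod, ← Finset.prod_mul_distrib]
    refine Finset.prod_congr rfl fun i _ ↦ ?_
    have hα : (⨅ j, (D j).U α) ⊓ (⨅ j, (D j).U β) ≤ (D i).U α ⊓ (D i).U β :=
      inf_le_inf (iInf_le _ i) (iInf_le _ i)
    rw [map_map, map_map, map_map,
      ← map_map (Y := Y) (inf_le_left : (D i).U α ⊓ (D i).U β ≤ (D i).U α) hα,
      ← map_map (Y := Y) (inf_le_right : (D i).U α ⊓ (D i).U β ≤ (D i).U β) hα,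
      ← map_map (Y := Y) (inf_le_left : (D i).U α ⊓ (D i).U β ≤ (D i).U α) hα,
      ← map_mul, (D i).ratio_mul_ratio]

variable (hcov : ⨆ α, (⨅ i, (D i).U α) = ⊤)

/-- The charts of `iInfProd` are the intersections `⋂_i (D i).U α`.
[cite: Hartshorne1977, II Thm. 7.1 (proof) and II Ex. 5.18] -/
@[simp]
theorem iInfProd_U (α : Γ) : (iInfProd D hcov).U α = ⨅ i, (D i).U α := rfl

/-- The ratios of `iInfProd` are the products `∏_i s^i_β / s^i_α` (restricted to the common chart).
[cite: Hartshorne1977, II Thm. 7.1 (proof) and II Ex. 5.18] -/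
theorem iInfProd_ratio (α β : Γ) :
    (iInfProd D hcov).ratio α β =
      ∏ i, Y.presheaf.map (homOfLE (iInf_le (fun i ↦ (D i).U α) i)).op ((D i).ratio α β) := rfl

/-- The charts of `iInfProd` are affine when `Y` is separated, `κ` is non-empty and every chart
`(D i).U α` is affine (a non-empty finite intersection of affine opens of a separated scheme is
affine, Mathlib `IsAffineOpen.iInf`). [cite: Hartshorne1977, II Ex. 4.3] -/
theorem isAffineOpen_iInfProd_U [Y.IsSeparated] [Nonempty κ]
    (hU : ∀ i α, IsAffineOpen ((D i).U α)) (α : Γ) : IsAffineOpen ((iInfProd D hcov).U α) :=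
  IsAffineOpen.iInf fun i ↦ hU i α

end IInfProd

/-! ### A morphism defined by generating sections is determined by its charts and ratios -/

section Congr

variable {ι : Type} {Y : Scheme.{u}} (D : GeneratingSections ι Y) {k : Type u} [CommRing k]
  (f : Y ⟶ Spec (.of k)) (i : ι) {T : Scheme.{u}} (g g' : T ⟶ Y) (hg : ⊤ ≤ g ⁻¹ᵁ D.U i)
  (hg' : ⊤ ≤ g' ⁻¹ᵁ D.U i)

/-- **Two maps `g, g' : T → Y` into the chart `U i` with the same `k`-structure which pull back
every ratio `s_j/s_i` to the same function have the same chart map `T → D₊(xᵢ) ⊆ ℙ(ι)`** (the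
chart map is `Spec` of `x_j/x_i ↦ g^*(s_j/s_i)`; Hartshorne II Thm. 7.1, uniqueness).
[cite: Hartshorne1977, II Thm. 7.1 (b)] -/
theorem chartMap_congr (hf : g ≫ f = g' ≫ f)
    (hr : ∀ j, res g (D.U i) hg (D.ratio i j) = res g' (D.U i) hg' (D.ratio i j)) :
    D.chartMap f i g hg = D.chartMap f i g' hg' := by
  have hfun : D.chartFun f i g hg = D.chartFun f i g' hg' := by
    apply MvPolynomial.ringHom_ext
    · intro c
      rw [chartFun_C, chartFun_C, hf]
    · intro j
      rw [chartFun_X, chartFun_X, hr]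
  have hring : D.chartRingHom f i g hg = D.chartRingHom f i g' hg' := by
    unfold chartRingHom
    congr 1
    apply IsLocalization.ringHom_ext (Submonoid.powers (MvPolynomial.X i : MvPolynomial ι k))
    rw [IsLocalization.Away.lift_comp, IsLocalization.Away.lift_comp, hfun]
  simp only [chartMap, hring]

end Congr

/-! ### The ratio `r^*((F_β/F_α)^m)` is the pull-back of the section `(F_β/F_α)^m` of `D₊(F_α)` -/

section FormRatio

variable {A : Type u} {σ : Type*} [CommRing A] [SetLike σ A] [AddSubgroupClass σ A]
  {𝒜 : ℕ → σ} [GradedRing 𝒜] {Y : Scheme.{u}} (r : Y ⟶ Proj 𝒜)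
  {Γ : Type} (F : Γ → A) {m : ℕ} (hF : ∀ α, F α ∈ 𝒜 m) (hm : 0 < m)

/-- The chart lift `r⁻¹D₊(F_α) → Spec A_{(F_α)}` is the restriction of `r` followed by
`D₊(F_α) ≅ Spec A_{(F_α)}` (both lift `r⁻¹D₊(F_α) → Y → Proj A` through the open immersion
`Spec A_{(F_α)} → Proj A`). [cite: Hartshorne1977, II Prop. 2.5 (b)] -/
theorem formChartLift_eq_morphismRestrict (α : Γ) :
    formChartLift r F hF hm α =
      (r ∣_ Proj.basicOpen 𝒜 (F α)) ≫ Proj.basicOpenToSpec 𝒜 (F α) := by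
  rw [← cancel_mono (formChartι F hF hm α), formChartLift_ι]
  change _ = (_ ≫ Proj.basicOpenToSpec 𝒜 (F α)) ≫ Proj.awayι 𝒜 (F α) (hF α) hm
  rw [Category.assoc, ← Proj.basicOpenIsoSpec_inv_ι, ← Proj.basicOpenIsoSpec_hom _ _ (hF α) hm,
    Iso.hom_inv_id_assoc, morphismRestrict_ι]

/-- **`r^*((F_β/F_α)^m)` is `r^*` of the section `(F_β/F_α)^m ∈ Γ(Proj A, D₊(F_α))`** (Mathlib
`Proj.awayToSection`), pulled back along `r` to `Γ(Y, r⁻¹D₊(F_α))` (Mathlib `Scheme.Hom.appLE`).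
[cite: Hartshorne1977, II Prop. 2.5 (b)] -/
theorem formHomRatio_eq_appLE (α β : Γ) :
    formHomRatio r F hF hm α β =
      r.appLE (Proj.basicOpen 𝒜 (F α)) (preUF r F α) le_rfl
        (Proj.awayToSection 𝒜 (F α) (formRatio 𝒜 (hF α) (hF β))) := by
  rw [formHomRatio, pull_apply, formChartLift_eq_morphismRestrict, Scheme.Hom.comp_appTop,
    CommRingCat.comp_apply]
  set c := formRatio 𝒜 (hF α) (hF β)
  have h1 : (Proj.basicOpenToSpec 𝒜 (F α)).appTop
      ((Scheme.ΓSpecIso (CommRingCat.of (Away 𝒜 (F α)))).inv c) =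
      (Proj.basicOpen 𝒜 (F α)).topIso.inv (Proj.awayToSection 𝒜 (F α) c) := by
    rw [Scheme.Hom.appTop, Proj.basicOpenToSpec_app_top, CommRingCat.comp_apply,
      CommRingCat.comp_apply, ← CommRingCat.comp_apply _ (Scheme.ΓSpecIso _).hom, Iso.inv_hom_id,
      CommRingCat.id_apply]
  rw [h1]
  have key : (Proj.basicOpen 𝒜 (F α)).topIso.inv ≫
      (r ∣_ Proj.basicOpen 𝒜 (F α)).appTop ≫ (preUF r F α).topIso.hom =
      r.appLE (Proj.basicOpen 𝒜 (F α)) (preUF r F α) le_rfl := by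
    rw [morphismRestrict_appTop]
    simp only [Scheme.Opens.topIso_inv, Scheme.Opens.topIso_hom, Scheme.Hom.app_eq_appLE,
      Scheme.Hom.appLE_map]
    erw [Scheme.Hom.appLE_map, Scheme.Hom.map_appLE]
  change ((Proj.basicOpen 𝒜 (F α)).topIso.inv ≫
      (r ∣_ Proj.basicOpen 𝒜 (F α)).appTop ≫ (preUF r F α).topIso.hom)
    (Proj.awayToSection 𝒜 (F α) c) = _
  rw [key]

/-- **Naturality of the ratios in `r`**: pulled back along any `h : T → Y` landing in
`r⁻¹D₊(F_α)`, the ratio `r^*((F_β/F_α)^m)` becomes `(h ≫ r)^*((F_β/F_α)^m)` — stated for any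
`φ = h ≫ r`. [cite: Hartshorne1977, II Prop. 2.5 (b)] -/
theorem res_formHomRatio {T : Scheme.{u}} (h : T ⟶ Y)
    (α β : Γ) (hT : ⊤ ≤ h ⁻¹ᵁ preUF r F α) (φ : T ⟶ Proj 𝒜) (hφ : h ≫ r = φ)
    (hφT : ⊤ ≤ φ ⁻¹ᵁ Proj.basicOpen 𝒜 (F α)) :
    res h (preUF r F α) hT (formHomRatio r F hF hm α β) =
      φ.appLE (Proj.basicOpen 𝒜 (F α)) ⊤ hφT
        (Proj.awayToSection 𝒜 (F α) (formRatio 𝒜 (hF α) (hF β))) := by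
  subst hφ
  rw [formHomRatio_eq_appLE]
  change (h.appLE (preUF r F α) ⊤ hT) (r.appLE (Proj.basicOpen 𝒜 (F α)) (preUF r F α) le_rfl
    (Proj.awayToSection 𝒜 (F α) (formRatio 𝒜 (hF α) (hF β)))) = _
  rw [← CommRingCat.comp_apply, Scheme.Hom.appLE_comp_appLE]

end FormRatio

end GeneratingSections

/-! ### §2 The norm data and the norm map -/

section Norm

variable {A : Type u} {σ : Type*} [CommRing A] [SetLike σ A] [AddSubgroupClass σ A]
  {𝒜 : ℕ → σ} [GradedRing 𝒜] {Y : Scheme.{u}} {κ : Type} [Fintype κ] (r : κ → (Y ⟶ Proj 𝒜))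
  {Γ : Type} (F : Γ → A) {m : ℕ} (hF : ∀ α, F α ∈ 𝒜 m) (hm : 0 < m)
  (hcov : ⨆ α, (⨅ i, r i ⁻¹ᵁ Proj.basicOpen 𝒜 (F α)) = ⊤)

include hcov in
omit [Fintype κ] in
/-- Under the joint covering hypothesis each family `r_i⁻¹ D₊(F_α)` (`α : Γ`) covers `Y` (the sections
`r_i^* F_α` generate). [cite: Hartshorne1977, II Thm. 7.1 (a)] -/
theorem iSup_preimage_basicOpen_eq_top (i : κ) : ⨆ α, r i ⁻¹ᵁ Proj.basicOpen 𝒜 (F α) = ⊤ :=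
  top_le_iff.mp (hcov.ge.trans (iSup_mono fun _ ↦ iInf_le _ i))

/-- **The norm data** of the family `r_i : Y → Proj A` (`i : κ`) and the forms `F_α ∈ A_m`:
charts `U_α = ⋂_i r_i⁻¹ D₊(F_α)`, ratios `∏_i r_i^*((F_β/F_α)^m)` — the generating sections
`N(F_α) = ∏_i r_i^* F_α^m` ("norms") of `⊗_i r_i^* 𝒪(m)` (Mumford AV §7, proof of the Theorem
p. 66: norms of sections are invariant sections without common zero). [cite: MumfordAV1970, §7 Thm. p. 66 (proof) and Remark p. 69] -/
def normData : GeneratingSections Γ Y :=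
  GeneratingSections.iInfProd
    (fun i ↦ GeneratingSections.ofForms (r i) F hF hm (iSup_preimage_basicOpen_eq_top r F hcov i))
    hcov

/-- The charts of the norm data are `⋂_i r_i⁻¹ D₊(F_α)`. [cite: MumfordAV1970, §7 Thm. p. 66 (proof)] -/
@[simp]
theorem normData_U (α : Γ) : (normData r F hF hm hcov).U α = ⨅ i, r i ⁻¹ᵁ Proj.basicOpen 𝒜 (F α) :=
  rfl

/-- The chart `⋂_i r_i⁻¹ D₊(F_α)` lies in each `r_i⁻¹ D₊(F_α)`. [cite: MumfordAV1970, §7 Thm. p. 66 (proof)] -/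
theorem normData_U_le (α : Γ) (i : κ) :
    (normData r F hF hm hcov).U α ≤ r i ⁻¹ᵁ Proj.basicOpen 𝒜 (F α) :=
  iInf_le (fun i ↦ r i ⁻¹ᵁ Proj.basicOpen 𝒜 (F α)) i

/-- The ratios of the norm data are `∏_i r_i^*((F_β/F_α)^m)` restricted to the chart.
[cite: MumfordAV1970, §7 Thm. p. 66 (proof)] -/
theorem normData_ratio (α β : Γ) :
    (normData r F hF hm hcov).ratio α β =
      ∏ i, Y.presheaf.map (homOfLE (normData_U_le r F hF hm hcov α i)).op
        (GeneratingSections.formHomRatio (r i) F hF hm α β) :=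
  rfl

/-- **The norm ratios pulled back along a map `h : T → Y` into the chart** are the products of the
pulled-back sections `(h ≫ r_i)^*((F_β/F_α)^m)` — stated for any family `φ_i = h ≫ r_i`, so that the
ratios are visibly natural in the family. [cite: Hartshorne1977, II Prop. 2.5 (b)] -/
theorem res_normData_ratio {T : Scheme.{u}} (h : T ⟶ Y) (α β : Γ)
    (hT : ⊤ ≤ h ⁻¹ᵁ (normData r F hF hm hcov).U α) (φ : κ → (T ⟶ Proj 𝒜))
    (hφ : ∀ i, h ≫ r i = φ i) (hφT : ∀ i, ⊤ ≤ φ i ⁻¹ᵁ Proj.basicOpen 𝒜 (F α)) :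
    GeneratingSections.res h ((normData r F hF hm hcov).U α) hT ((normData r F hF hm hcov).ratio α β) =
      ∏ i, (φ i).appLE (Proj.basicOpen 𝒜 (F α)) ⊤ (hφT i)
        (Proj.awayToSection 𝒜 (F α) (GeneratingSections.formRatio 𝒜 (hF α) (hF β))) := by
  rw [normData_ratio, map_prod]
  refine Finset.prod_congr rfl fun i _ ↦ ?_
  rw [GeneratingSections.res_map h _
    (hT.trans ((Opens.map h.base).map (homOfLE (normData_U_le r F hF hm hcov α i))).le)]
  exact GeneratingSections.res_formHomRatio (r i) F hF hm h α β _ (φ i) (hφ i) (hφT i)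

/-- The charts of the norm data are affine for `Y` separated, `κ` non-empty and affine `r_i`
(`D₊(F_α)` is affine, Mathlib `Proj.isAffineOpen_basicOpen`). [cite: Hartshorne1977, II Prop. 2.5 (b) and II Ex. 4.3] -/
theorem isAffineOpen_normData_U [Y.IsSeparated] [Nonempty κ] [∀ i, IsAffineHom (r i)] (α : Γ) :
    IsAffineOpen ((normData r F hF hm hcov).U α) := by
  rw [normData_U]
  exact IsAffineOpen.iInf fun i ↦ (Proj.isAffineOpen_basicOpen 𝒜 (F α) (hF α) hm).preimage (r i)

end Norm

section NormMap

variable {k : Type u} [Field k] {A : Type u} {σ : Type*} [CommRing A] [SetLike σ A]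
  [AddSubgroupClass σ A] {𝒜 : ℕ → σ} [GradedRing 𝒜] {Z : SchemeOver k} {κ : Type} [Fintype κ]
  (r : κ → (Z.left ⟶ Proj 𝒜)) {L : ℕ} (F : Fin (L + 1) → A) {m : ℕ} (hF : ∀ α, F α ∈ 𝒜 m)
  (hm : 0 < m) (hcov : ⨆ α, (⨅ i, r i ⁻¹ᵁ Proj.basicOpen 𝒜 (F α)) = ⊤)

/-- **The norm map** `N : Z ⟶ ℙᴸ_k`, `z ↦ [… : ∏_i F_α(r_i z) : …]`, of a family of morphisms
`r_i : Z → Proj A` and `L + 1` forms `F_α` of equal positive degree whose charts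
`⋂_i r_i⁻¹D₊(F_α)` cover `Z` (the morphism defined by the norm data, Hartshorne II Thm. 7.1).
[cite: MumfordAV1970, §7 Thm. p. 66 (proof) and Remark p. 69] [cite: Hartshorne1977, II Thm. 7.1 (b)] -/
def normMap : Z ⟶ projectiveSpace L k :=
  (normData r F hF hm hcov).toProjectiveSpace

/-- `N⁻¹ D₊(y_α) = ⋂_i r_i⁻¹ D₊(F_α)`. [cite: Hartshorne1977, II Thm. 7.1 (b)] -/
theorem normMap_left_preimage_basicOpen (α : Fin (L + 1)) :
    (normMap r F hF hm hcov).left ⁻¹ᵁ Proj.basicOpen (grading (Fin (L + 1)) k) (MvPolynomial.X α) =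
      ⨅ i, r i ⁻¹ᵁ Proj.basicOpen 𝒜 (F α) :=
  GeneratingSections.toProj_preimage_basicOpen (normData r F hF hm hcov) Z.hom α

/-- **The norm map is an affine morphism** for `Z` separated, `κ` non-empty and affine `r_i`
(affineness is local on the target; over the chart `D₊(y_α)` of `ℙᴸ` the preimage is the affine
`⋂_i r_i⁻¹D₊(F_α)`). [cite: GortzWedhorn2020, Thm. 13.84] -/
theorem isAffineHom_normMap_left [Z.left.IsSeparated] [Nonempty κ] [∀ i, IsAffineHom (r i)] :
    IsAffineHom (normMap r F hF hm hcov).left := by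
  letI := MvPolynomial.gradedAlgebra (σ := Fin (L + 1)) (R := k)
  refine (HasAffineProperty.iff_of_iSup_eq_top (P := @IsAffineHom) (f := (normMap r F hF hm hcov).left)
    (fun α : Fin (L + 1) ↦ ⟨Proj.basicOpen (grading (Fin (L + 1)) k) (MvPolynomial.X α),
      Proj.isAffineOpen_basicOpen _ _ (X_mem k α) zero_lt_one⟩)
    (Proj.iSup_basicOpen_eq_top (grading (Fin (L + 1)) k) (fun α : Fin (L + 1) ↦ MvPolynomial.X α)
      (irrelevant_le_span_X (Fin (L + 1)) k))).2 fun α ↦ ?_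
  change IsAffineOpen ((normMap r F hF hm hcov).left ⁻¹ᵁ
    Proj.basicOpen (grading (Fin (L + 1)) k) (MvPolynomial.X α))
  rw [normMap_left_preimage_basicOpen]
  exact isAffineOpen_normData_U r F hF hm hcov α

/-- **The norm map is finite** for `Z` proper over `k` (and separated, `κ` non-empty, affine `r_i`):
it is affine and proper, the target `ℙᴸ_k` being separated over `k` (Mathlib
`IsFinite.iff_isProper_and_isAffineHom`; Görtz–Wedhorn I Thm. 13.84: for proper `X` a morphism to
`ℙ(𝓔)` is finite iff affine iff the pulled-back `𝒪(1)` is ample). [cite: GortzWedhorn2020, Thm. 13.84 (2)] -/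
theorem isFinite_normMap_left [IsProper Z.hom] [Nonempty κ] [∀ i, IsAffineHom (r i)] :
    IsFinite (normMap r F hF hm hcov).left := by
  haveI : Z.left.IsSeparated := ⟨by rw [← terminal.comp_from Z.hom]; infer_instance⟩
  haveI := isAffineHom_normMap_left r F hF hm hcov
  have h1 : IsProper ((normMap r F hF hm hcov).left ≫ (projectiveSpace L k).hom) := by
    rw [Over.w]; infer_instance
  haveI : IsProper (projectiveSpace L k).hom := isProper_projectiveSpace L k
  have h2 : IsSeparated (projectiveSpace L k).hom := inferInstance
  haveI : IsProper (normMap r F hF hm hcov).left := IsProper.of_comp _ (projectiveSpace L k).hom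
  exact IsFinite.iff_isProper_and_isAffineHom.2 ⟨inferInstance, inferInstance⟩

/-! ### §3 Invariance under automorphisms permuting the family -/

/-- **Invariance of the norm map**: if `g : Z ⟶ Z` over `k` permutes the family —
`g ≫ r_i = r_{σ i}` for a permutation `σ` of `κ` — then `g ≫ N = N` (the charts `⋂_i r_i⁻¹D₊(F_α)`
are `g`-stable, the ratios `∏_i r_i^*((F_β/F_α)^m)` are `g`-invariant, and a morphism to `ℙᴸ`
defined by generating sections is determined by these; Mumford AV §7: the norms
`∏_{g ∈ G} g^*F` are `G`-invariant). [cite: MumfordAV1970, §7 Thm. p. 66 (proof)] -/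
theorem comp_normMap_eq (g : Z ⟶ Z) (σ : κ ≃ κ) (hg : ∀ i, g.left ≫ r i = r (σ i)) :
    g ≫ normMap r F hF hm hcov = normMap r F hF hm hcov := by
  ext : 1
  rw [Over.comp_left, normMap, GeneratingSections.toProjectiveSpace_left]
  change (g.left ≫ (normData r F hF hm hcov).toProj Z.hom :
      Z.left ⟶ Proj (grading (Fin (L + 1)) k)) = (normData r F hF hm hcov).toProj Z.hom
  -- the charts are `g`-stable
  have hstab : ∀ α, g.left ⁻¹ᵁ (normData r F hF hm hcov).U α = (normData r F hF hm hcov).U α := by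
    intro α
    rw [normData_U, preimage_iInf]
    simp_rw [← Scheme.Hom.comp_preimage, hg]
    exact Equiv.iInf_comp (g := fun i ↦ r i ⁻¹ᵁ Proj.basicOpen 𝒜 (F α)) σ
  refine Scheme.Cover.hom_ext (normData r F hF hm hcov).cover _ _ fun α ↦ ?_
  have h0 : ⊤ ≤ ((normData r F hF hm hcov).U α).ι ⁻¹ᵁ (normData r F hF hm hcov).U α :=
    GeneratingSections.top_le_ι_preimage _
  have h1 : ⊤ ≤ (((normData r F hF hm hcov).U α).ι ≫ g.left) ⁻¹ᵁ (normData r F hF hm hcov).U α := by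
    rw [Scheme.Hom.comp_preimage, hstab]; exact h0
  rw [GeneratingSections.cover_f, ← Category.assoc,
    (normData r F hF hm hcov).comp_toProj Z.hom (((normData r F hF hm hcov).U α).ι ≫ g.left) h1,
    (normData r F hF hm hcov).comp_toProj Z.hom ((normData r F hF hm hcov).U α).ι h0]
  refine (normData r F hF hm hcov).chartMap_congr Z.hom α _ _ h1 h0
    (by rw [Category.assoc, Over.w g]) fun β ↦ ?_
  -- the ratios are `g`-invariant
  have hT : ∀ i, ⊤ ≤ (((normData r F hF hm hcov).U α).ι ≫ r i) ⁻¹ᵁ Proj.basicOpen 𝒜 (F α) :=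
    fun i ↦ by
      rw [Scheme.Hom.comp_preimage]
      exact h0.trans ((Opens.map _).map (homOfLE (normData_U_le r F hF hm hcov α i))).le
  rw [res_normData_ratio r F hF hm hcov _ α β h1
      (fun i ↦ ((normData r F hF hm hcov).U α).ι ≫ r (σ i))
      (fun i ↦ by rw [Category.assoc, hg]) (fun i ↦ hT (σ i)),
    res_normData_ratio r F hF hm hcov _ α β h0
      (fun i ↦ ((normData r F hF hm hcov).U α).ι ≫ r i) (fun i ↦ rfl) hT]
  exact Equiv.prod_comp σ (fun i ↦ (((normData r F hF hm hcov).U α).ι ≫ r i).appLE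
    (Proj.basicOpen 𝒜 (F α)) ⊤ (hT i)
    (Proj.awayToSection 𝒜 (F α) (GeneratingSections.formRatio 𝒜 (hF α) (hF β))))

end NormMap

end Literature.AlgebraicGeometry.Motives

end
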